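import Summits.QuantumFields.GaugeBoot.TiltedBoxRedSiteRPNegative
import Summits.QuantumFields.GaugeBoot.TiltedBoxEvenAxisRPTwoDim
import Summits.QuantumFields.GaugeBoot.PeriodicUniformEstimate
import HarnessLib

/-!
# Reduced-half site RP fails on the even square tilted boxes in `d ≥ 3` in a coupling window UNIFORM in the box (gauge-boot, L3 supplement: uniform reduced-half window, 5/6)

HONEST FRAMING (cell `pub-gaugeboot`, page 1 of every file): the venture produces certified bounds
on lattice expectations at stated coupling, gauge group, dimension and torus size; NOT a mass gap,
NOT a continuum limit, NOT a string tension; NOT Yang–Mills-summit-bearing (barriers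
`FixedCouplingUltralocality`, `PerturbativeInvisibility`). This module is a small structural
NEGATIVE result about which positivity blocks a certificate on the tilted box may use; it
discharges nothing else.

## Content

`TiltedBoxRedSiteRPNegative.lean` (gen 51) proves: on the even square tilted box
`ℤ^d/Γ(2P, 2P, L)` (`P ≥ 2`, `L ≥ 2`) with a transverse direction pair (`d ≥ 3`), reduced-half
site RP along `i` (`TwoDim.IsRedSiteLink`, half `{0 ≤ x_i ≤ P - 1}`) FAILS for `0 < β ≤ β₀`, with a
`β₀ = β₀(box)` shrinking like `2^{-#rest plaquettes}` (the tail `|Q| ≥ 9` of the back expansion was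
bounded term by term). Here the SAME trick sum is resummed with the periodic-lattice polymer
bookkeeping `PeriodicPlaquetteAdjacency` … `PeriodicUniformEstimate` (seed-connected part ×
positive partial partition function of the detached rest; Kotecký–Preiss entropy; NO cluster
expansion), and gen 51's cover/tube theorems supply exactly its shape hypotheses:

* **`RedSiteRP d i j L P ρ hij β`** — the reduced-half site-RP statement itself as a `Prop` (verbatim the `∀ F …` conclusion of `TwoDim.tiltedBox_axisRP_even_twoDim`;
  anchored by **`TwoDim.redSiteRP_twoDim`**, its `d = 2` positive instance);
* **`trickSum_eq_sum_combo`**, **`touch_of_mem_tube`** (the eight tube plaquettes touch the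
  seed links);
* ★★ **`trickSum_neg_of_window`** — for `0 < β` with `144 d² N β ≤ 1`, `2⁹ N¹⁰ β ≤ c₁⁹`,
  `3960 · 144⁹ d¹⁸ N¹⁰ β ≤ c₁⁹` — conditions that mention neither `P` nor `L` — `trickSum < 0`;
* ★★★ **`not_redSiteRP_uniform_of_moments`** / **`_specialUnitary`** (`SU(N)`, `N ≥ 2`) /
  **`_unitary`** (`U(N)`, `N ≥ 1`) / **`_of_axis`** (a transverse axis `k ∉ {i, j}`): there is
  ONE `β₀ = β₀(d, N, c₁) > 0` such that reduced-half site RP along `i` fails on EVERY even square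
  tilted box `P ≥ 2`, `L ≥ 2` for all `0 < β ≤ β₀`. Hence at fixed small `β` it is not even
  EVENTUALLY available along the boxes: the finite-volume route by which
  `TiltedBoxLimitClassBTwoDimAll` (gen 50) transfers in-plane site RP to the tilted LIMIT points in
  `d = 2` is closed in `d ≥ 3` at small coupling (the limit statement itself stays open there;
  under DLR uniqueness it holds). Concrete `ℤ³` corollaries: `TiltedBoxReducedHalfUniformWindow`.

`β₀` is explicit and absurdly small, not optimised; nothing is claimed at moderate `β`. Mechanism
folklore (strong-coupling polymer resummation, Osterwalder–Seiler 1978 §3, Friedli–Velenik 2017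
§5.2; tube: M. Creutz 1983 Ch. 8–10); statements new as theorems.
-/

noncomputable section

open QuotientAddGroup Finset Function MeasureTheory
open scoped ComplexConjugate ComplexOrder
open Literature.MathematicalPhysics.QuantumFieldTheory (haarProbability IsSpecialUnitaryModel IsUnitaryModel)
open Literature.MathematicalPhysics.QuantumFieldTheory.PlaquetteLowerBound (reTr)
open Literature.RepresentationTheory.CompactGroups

namespace Summit.QuantumFields.GaugeBoot

namespace TiltedRP

namespace RedSite

variable {d : ℕ} {i j : Fin d} {L P N : ℕ} [NeZero L] [NeZero P]
variable {G : Type*} [Group G] [TopologicalSpace G] [IsTopologicalGroup G] [CompactSpace G]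
  [MeasurableSpace G] [BorelSpace G] [SecondCountableTopology G]
variable (ρ : G →* Matrix (Fin N) (Fin N) ℂ) (q : DirPair d)

/-! ## The reduced-half site-RP statement -/

variable (d i j L P) in
/-- **Reduced-half site reflection positivity along `i` on the even square tilted box
`ℤ^d/Γ(2P, 2P, L)` at coupling `β`**: `0 ≤ ∫ conj F(Θ_i U) F(U) dμ_β` for every bounded measurable
`F` reading only the links of the reduced half `{0 ≤ x_i ≤ P - 1}` (`TwoDim.IsRedSiteLink`) —
verbatim the conclusion of `TwoDim.tiltedBox_axisRP_even_twoDim` (gen 50: TRUE in `d = 2` at every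
`β`) and the statement negated by `not_tiltedBox_axisRP_even_red_of_moments` (gen 51). [shape] A
parametric definition of a proposition — NOT a fact. [folklore] -/
def RedSiteRP (hij : i ≠ j) (β : ℝ) : Prop :=
  ∀ F : Config (TiltedSite d i j (2 * P) (2 * P) L) d G → ℂ, Measurable F →
    (∃ C : ℝ, ∀ U, ‖F U‖ ≤ C) →
    (∀ U V : Config (TiltedSite d i j (2 * P) (2 * P) L) d G,
      (∀ l, TwoDim.IsRedSiteLink (P := P) l → U l = V l) → F U = F V) →
    0 ≤ ∫ U, conj (F (configReflect (tiltedUnit d i j (2 * P) (2 * P) L) i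
      (tiltedAxisFlip d L (2 * P) hij) U)) * F U ∂(gibbs ρ (tiltedUnit d i j (2 * P) (2 * P) L) β)

/-- **Anchor: in two dimensions `RedSiteRP` HOLDS at every real `β`** (`P ≥ 2`; this is
`TwoDim.tiltedBox_axisRP_even_twoDim`, restated through the definition). [folklore] -/
theorem _root_.Summit.QuantumFields.GaugeBoot.TiltedRP.TwoDim.redSiteRP_twoDim (hP : 2 ≤ P)
    (hij : i ≠ j) (hd : ∀ k : Fin d, k = i ∨ k = j) (hρ : Continuous ρ) (β : ℝ) :
    RedSiteRP d i j L P ρ hij β :=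
  fun F hFm hFb hFo => TwoDim.tiltedBox_axisRP_even_twoDim ρ hP hij hd hρ β F hFm hFb hFo

/-- A negative trick sum refutes `RedSiteRP` (`not_redSiteRP_of_trickSum_neg`, restated). [folklore] -/
theorem not_redSiteRP_of_trickSum_neg' (hP : 2 ≤ P) (hij : i ≠ j) (hq1 : q.1.1 ≠ i)
    (hq2 : q.1.2 ≠ i) (hρ : Continuous ρ) {β : ℝ} (hneg : trickSum d i j L P ρ q β < 0) :
    ¬ RedSiteRP d i j L P ρ hij β :=
  not_redSiteRP_of_trickSum_neg ρ q hP hij hq1 hq2 hρ hneg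

/-! ## The trick sum as a resummable combination -/

omit [SecondCountableTopology G] in
/-- The trick sum is the expansion `Σ_{Q ⊆ rest} combo(Q)` of `PeriodicSeedResum` with
`u₁ = vUpT`, `u₂ = vUp`, `v₁ = vLo`, `v₂ = vLoT`. [folklore] -/
theorem trickSum_eq_sum_combo (β : ℝ) :
    trickSum d i j L P ρ q β = ∑ Q ∈ (restSet d i j L P).powerset,
      PairExp.combo ρ (tiltedUnit d i j (2 * P) (2 * P) L) β (vUpT d i j L P q) (vUp d i j L P q)
        (vLo d i j L P q) (vLoT d i j L P q) Q := by
  unfold trickSum PairExp.combo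
  rfl

omit [NeZero L] [NeZero P] in
/-- **The standing plaquette on a link of direction `≠ i` contains that link.** [folklore] -/
theorem hasLink_stand_self {ℓ : Link (TiltedSite d i j (2 * P) (2 * P) L) d} (hm : ℓ.2 ≠ i) :
    PairExp.HasLink (tiltedUnit d i j (2 * P) (2 * P) L) (stand q ℓ) ℓ := by
  obtain ⟨z, m⟩ := ℓ
  exact (hasLink_stand_iff q hm _).2 (Or.inr (Or.inr (Or.inr rfl)))

omit [NeZero L] [NeZero P] in
/-- **The hanging plaquette under a link of direction `≠ i` contains that link.** [folklore] -/
theorem hasLink_hang_self {ℓ : Link (TiltedSite d i j (2 * P) (2 * P) L) d} (hm : ℓ.2 ≠ i) :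
    PairExp.HasLink (tiltedUnit d i j (2 * P) (2 * P) L) (hang q ℓ) ℓ := by
  obtain ⟨w, m⟩ := ℓ
  exact (hasLink_hang_iff q hm _).2 (Or.inr (Or.inl rfl))

omit [NeZero L] [NeZero P] in
/-- **The tube plaquettes touch the seed links**: every plaquette of `tube q u v` between two
TRANSVERSE plaquettes `u = (w; q)`, `v = (z; q)` contains a link of `u` or of `v`, hence a seed link
of any four-plaquette family containing `u` and `v`. [folklore] -/
theorem touch_of_mem_tube [DecidableEq (TiltedSite d i j (2 * P) (2 * P) L)] (hq1 : q.1.1 ≠ i)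
    (hq2 : q.1.2 ≠ i) {w z : TiltedSite d i j (2 * P) (2 * P) L}
    {K : Finset (Link (TiltedSite d i j (2 * P) (2 * P) L) d)}
    (hu : PairExp.plinks (tiltedUnit d i j (2 * P) (2 * P) L) ((w, q) : Plaq _ d) ⊆ K)
    (hv : PairExp.plinks (tiltedUnit d i j (2 * P) (2 * P) L) ((z, q) : Plaq _ d) ⊆ K)
    {p : Plaq (TiltedSite d i j (2 * P) (2 * P) L) d} (hp : p ∈ tube q (w, q) (z, q)) :
    PairExp.Touch (tiltedUnit d i j (2 * P) (2 * P) L) K p := by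
  rcases (mem_tube q).1 hp with ⟨a, rfl⟩ | ⟨a, rfl⟩
  · have hdir := (hasLink_transverse q hq1 hq2 z
      (ℓ := PairExp.plink (tiltedUnit d i j (2 * P) (2 * P) L) ((z, q) : Plaq _ d) a) ⟨a, rfl⟩).2
    exact PairExp.touch_iff.2 ⟨_, hv (PairExp.plink_mem_plinks _ _ a), hasLink_stand_self q hdir⟩
  · have hdir := (hasLink_transverse q hq1 hq2 w
      (ℓ := PairExp.plink (tiltedUnit d i j (2 * P) (2 * P) L) ((w, q) : Plaq _ d) a) ⟨a, rfl⟩).2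
    exact PairExp.touch_iff.2 ⟨_, hu (PairExp.plink_mem_plinks _ _ a), hasLink_hang_self q hdir⟩

/-! ## The trick sum is negative in a box-independent window -/

/-- ★★ **The trick sum is negative in a window that does not mention the box** (`P ≥ 2`, `L ≥ 2`,
`q₁, q₂ ≠ i`, centre element, (R1) with `c₁ > 0`, `N ≥ 1`): for `0 < β` with `144 d² N β ≤ 1`,
`2⁹ N¹⁰ β ≤ c₁⁹` and `3960 · 144⁹ d¹⁸ N¹⁰ β ≤ c₁⁹`, `trickSum < 0`. [folklore] -/
theorem trickSum_neg_of_window (hP : 2 ≤ P) (hij : i ≠ j) (hL : 2 ≤ L) (hq1 : q.1.1 ≠ i)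
    (hq2 : q.1.2 ≠ i) (hρ : Continuous ρ) (hN : 1 ≤ N) {z₀ : G} {ω : ℂ}
    (hz₀ : ρ z₀ = ω • (1 : Matrix (Fin N) (Fin N) ℂ)) (hω : ω ≠ 1) {c₁ : ℝ} (hc₁ : 0 < c₁)
    (hR1 : ∀ x y : G, ∫ g, reTr ρ (x * g⁻¹) * reTr ρ (g * y) ∂haarProbability G = c₁ * reTr ρ (x * y))
    {β : ℝ} (hβ : 0 < β) (hβ2 : 144 * (d : ℝ) ^ 2 * N * β ≤ 1)
    (hβ3 : 2 ^ 9 * (N : ℝ) ^ 10 * β ≤ c₁ ^ 9)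
    (hβ4 : 3960 * 144 ^ 9 * (d : ℝ) ^ 18 * N ^ 10 * β ≤ c₁ ^ 9) :
    trickSum d i j L P ρ q β < 0 := by
  classical
  have hd : 1 ≤ d := Fin.pos i
  have hd' : (1 : ℝ) ≤ d := by exact_mod_cast hd
  have hNr : (1 : ℝ) ≤ N := by exact_mod_cast hN
  have hβN0 : 0 ≤ β * N := by positivity
  have hd2 : (1 : ℝ) ≤ (d : ℝ) ^ 2 := by nlinarith
  have hX : β * N ≤ (d : ℝ) ^ 2 * (β * N) := le_mul_of_one_le_left hβN0 hd2
  have e144 : 144 * (d : ℝ) ^ 2 * N * β = 144 * ((d : ℝ) ^ 2 * (β * N)) := by ring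
  have hβN1 : β * N ≤ 1 := by linarith
  set e := tiltedUnit d i j (2 * P) (2 * P) L with he_def
  set T := tiltedTwist d L (2 * P) (i := i) (j := j) with hT_def
  set y := (TwoDim.predLayerSite d L P : TiltedSite d i j (2 * P) (2 * P) L) with hy_def
  set R := restSet d i j L P with hR_def
  have hy : (axisCoord d L (2 * P) y).val = P - 1 := TwoDim.val_axisCoord_predLayerSite hP
  have hyT : (axisCoord d L (2 * P) (y + T)).val = P - 1 := by
    rw [map_add, hT_def, axisCoord_tiltedTwist d L _ hij, add_zero, hy]
  -- geometry of the four plaquettes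
  have hUpT : y + e i + e i + T = (y + T) + e i + e i := by abel
  have hUp : y + e i + e i = (y + T) + e i + e i + T := by
    rw [show (y + T) + e i + e i + T = y + e i + e i + (T + T) by abel, hT_def,
      tiltedTwist_add_tiltedTwist d L _ hij, add_zero]
  have hw : (axisCoord d L (2 * P) (y + e i + e i)).val = P + 1 := by
    rw [val_axisCoord_add_self hP _ (by rw [val_axisCoord_up hP hy]; omega), val_axisCoord_up hP hy]
  have hwT : (axisCoord d L (2 * P) (y + T + e i + e i)).val = P + 1 := by
    rw [val_axisCoord_add_self hP _ (by rw [val_axisCoord_up hP hyT]; omega), val_axisCoord_up hP hyT]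
  have hvUpT : vUpT d i j L P q = (y + T + e i + e i, q) := by
    unfold vUpT; rw [← hy_def, ← he_def, ← hT_def, hUpT]
  have hvUp : vUp d i j L P q = (y + e i + e i, q) := rfl
  have hvLo : vLo d i j L P q = (y, q) := rfl
  have hvLoT : vLoT d i j L P q = (y + T, q) := rfl
  -- the two tubes (`M₁` above `v + T`, `M₂` above `v`)
  have hM₁R : tube q (y + T + e i + e i, q) (y + T, q) ⊆ R := tube_subset_restSet q hP hq1 hq2 hyT hwT
  have hM₂R : tube q (y + e i + e i, q) (y, q) ⊆ R := tube_subset_restSet q hP hq1 hq2 hy hw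
  have hM₁n : (tube q (y + T + e i + e i, q) (y + T, q)).card ≤ 8 := by
    rw [card_tube q hP hij hL hq1 hq2 hyT hwT]
  have hM₂n : (tube q (y + e i + e i, q) (y, q)).card ≤ 8 := by
    rw [card_tube q hP hij hL hq1 hq2 hy hw]
  have hM₁K : ∀ p ∈ tube q (y + T + e i + e i, q) (y + T, q), PairExp.Touch e
      (PairExp.seedLinks e (vUpT d i j L P q) (vUp d i j L P q) (vLo d i j L P q) (vLoT d i j L P q)) p :=
    fun p hp => touch_of_mem_tube q hq1 hq2 (by rw [← hvUpT]; exact PairExp.plinks_u₁_subset e _ _ _ _)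
      (PairExp.plinks_v₂_subset e _ _ _ _) hp
  have hM₂K : ∀ p ∈ tube q (y + e i + e i, q) (y, q), PairExp.Touch e
      (PairExp.seedLinks e (vUpT d i j L P q) (vUp d i j L P q) (vLo d i j L P q) (vLoT d i j L P q)) p :=
    fun p hp => touch_of_mem_tube q hq1 hq2 (PairExp.plinks_u₂_subset e _ _ _ _)
      (PairExp.plinks_v₁_subset e _ _ _ _) hp
  -- the shape theorems of gen 51: far terms vanish, near terms are the tube terms
  have h11 : ∀ Q ⊆ R, Q.card ≤ 8 → PairExp.pairT ρ e β Q (vUpT d i j L P q) (vLo d i j L P q) = 0 :=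
    fun Q hQ hc => pairT_far_eq_zero ρ q hP hij hL hq1 hq2 hρ hz₀ hω β hy hQ hc
  have h22 : ∀ Q ⊆ R, Q.card ≤ 8 → PairExp.pairT ρ e β Q (vUp d i j L P q) (vLoT d i j L P q) = 0 := by
    intro Q hQ hc
    rw [hvUp, hvLoT, hUp]
    exact pairT_far_eq_zero ρ q hP hij hL hq1 hq2 hρ hz₀ hω β hyT hQ hc
  have h12 : ∀ Q ⊆ R, Q.card ≤ 8 → PairExp.pairT ρ e β Q (vUpT d i j L P q) (vLoT d i j L P q) ≠ 0 →
      Q = tube q (y + T + e i + e i, q) (y + T, q) := by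
    intro Q hQ hc hne
    rw [hvUpT, hvLoT] at hne
    exact eq_tube_of_pairT_ne_zero ρ q hP hij hL hq1 hq2 hρ hz₀ hω hyT hwT hQ hc hne
  have h21 : ∀ Q ⊆ R, Q.card ≤ 8 → PairExp.pairT ρ e β Q (vUp d i j L P q) (vLo d i j L P q) ≠ 0 →
      Q = tube q (y + e i + e i, q) (y, q) := fun Q hQ hc hne =>
    eq_tube_of_pairT_ne_zero ρ q hP hij hL hq1 hq2 hρ hz₀ hω hy hw hQ hc hne
  -- the tube values
  have hmle : β ^ 8 * (c₁ ^ 9 * N) / 2 ≤ β ^ 8 * (c₁ ^ 9 * N) - N ^ 2 * (2 ^ 8 * (β * N) ^ 9) := by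
    have h := mul_le_mul_of_nonneg_right hβ3 (by positivity : (0 : ℝ) ≤ β ^ 8 * N)
    have e1 : (N : ℝ) ^ 2 * (2 ^ 8 * (β * N) ^ 9) = 2 ^ 9 * (N : ℝ) ^ 10 * β * (β ^ 8 * N) / 2 := by
      ring
    have e2 : β ^ 8 * (c₁ ^ 9 * N) = c₁ ^ 9 * (β ^ 8 * N) := by ring
    rw [e1, e2]
    linarith
  have hm₁ : β ^ 8 * (c₁ ^ 9 * N) / 2 ≤ PairExp.pairT ρ e β (tube q (y + T + e i + e i, q) (y + T, q))
      (vUpT d i j L P q) (vLoT d i j L P q) := by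
    rw [hvUpT, hvLoT]
    exact hmle.trans (pairT_tube_ge ρ q hR1 hP hij hL hq1 hq2 hρ hβ.le hβN1 hyT)
  have hm₂ : β ^ 8 * (c₁ ^ 9 * N) / 2 ≤ PairExp.pairT ρ e β (tube q (y + e i + e i, q) (y, q))
      (vUp d i j L P q) (vLo d i j L P q) :=
    hmle.trans (pairT_tube_ge ρ q hR1 hP hij hL hq1 hq2 hρ hβ.le hβN1 hy)
  -- the window
  have hβ1 : (32 + 8 * ((8 : ℕ) : ℝ)) * (d : ℝ) ^ 2 * N * β ≤ 1 := by
    have e' : (32 + 8 * ((8 : ℕ) : ℝ)) * (d : ℝ) ^ 2 * N * β = 96 * ((d : ℝ) ^ 2 * (β * N)) := by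
      push_cast; ring
    have hX0 : 0 ≤ (d : ℝ) ^ 2 * (β * N) := by positivity
    linarith
  have hwin : 660 * (N : ℝ) ^ 2 * (144 * (d : ℝ) ^ 2 * N * β) ^ (8 + 1) <
      2 / 3 * (β ^ 8 * (c₁ ^ 9 * N) / 2) := by
    have hlt : 1980 * 144 ^ 9 * (d : ℝ) ^ 18 * N ^ 10 * β < c₁ ^ 9 := by
      have : (0 : ℝ) < c₁ ^ 9 := by positivity
      linarith
    have h := mul_lt_mul_of_pos_right hlt (by positivity : (0 : ℝ) < β ^ 8 * N)
    have e1 : 660 * (N : ℝ) ^ 2 * (144 * (d : ℝ) ^ 2 * N * β) ^ (8 + 1) =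
        1980 * 144 ^ 9 * (d : ℝ) ^ 18 * N ^ 10 * β * (β ^ 8 * N) / 3 := by ring
    have e2 : 2 / 3 * (β ^ 8 * (c₁ ^ 9 * N) / 2) = c₁ ^ 9 * (β ^ 8 * N) / 3 := by ring
    rw [e1, e2]
    linarith
  rw [trickSum_eq_sum_combo ρ q β]
  exact PairExp.sum_combo_neg ρ e β (u₁ := vUpT d i j L P q) (u₂ := vUp d i j L P q)
    (v₁ := vLo d i j L P q) (v₂ := vLoT d i j L P q) (R := R) hρ hβ.le hβN1 hM₁R hM₂R hM₁K hM₂K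
    hM₁n hM₂n h11 h22 h12 h21 (by positivity) hm₁ hm₂ hd hβ1 hβ2 hwin

end RedSite

/-! ## The uniform theorem -/

namespace RedSite

section Uniform

variable {d : ℕ} {i j : Fin d} {N : ℕ}
variable {G : Type*} [Group G] [TopologicalSpace G] [IsTopologicalGroup G] [CompactSpace G]
  [MeasurableSpace G] [BorelSpace G] [SecondCountableTopology G]
variable (ρ : G →* Matrix (Fin N) (Fin N) ℂ) (q : DirPair d)

/-- ★★★ **REDUCED-half site RP along `i` FAILS on EVERY even square tilted box `ℤ^d/Γ(2P, 2P, L)`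
(`P ≥ 2`, `L ≥ 2`) in `d ≥ 3`, in ONE coupling window, from the character moments**: a direction
pair `q = (q₁, q₂)` with `q₁, q₂ ≠ i` (it exists iff `d ≥ 3`), compact metrisable `G`, continuous `ρ`
(`N ≥ 1`) with a centre element `ρ z₀ = ω • 1`, `ω ≠ 1`, and (R1) with `c₁ > 0`. Then there is
`β₀ = β₀(d, N, c₁) > 0` — NOT depending on the box — such that `¬ RedSiteRP` for every `P ≥ 2`,
`L ≥ 2` and every `0 < β ≤ β₀`. (Gen 51's `not_tiltedBox_axisRP_even_red_of_moments` had
`β₀ = β₀(P, L)`.) [folklore] -/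
theorem not_redSiteRP_uniform_of_moments (hij : i ≠ j) (hq1 : q.1.1 ≠ i) (hq2 : q.1.2 ≠ i)
    (hρ : Continuous ρ) (hN : 1 ≤ N) {z₀ : G} {ω : ℂ}
    (hz₀ : ρ z₀ = ω • (1 : Matrix (Fin N) (Fin N) ℂ)) (hω : ω ≠ 1) {c₁ : ℝ} (hc₁ : 0 < c₁)
    (hR1 : ∀ x y : G, ∫ g, reTr ρ (x * g⁻¹) * reTr ρ (g * y) ∂haarProbability G = c₁ * reTr ρ (x * y)) :
    ∃ β₀ : ℝ, 0 < β₀ ∧ ∀ (P L : ℕ) [NeZero P] [NeZero L], 2 ≤ P → 2 ≤ L →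
      ∀ β : ℝ, 0 < β → β ≤ β₀ → ¬ RedSiteRP d i j L P ρ hij β := by
  have hd0 : (0 : ℝ) < d := by exact_mod_cast Fin.pos i
  have hN0 : (0 : ℝ) < N := by exact_mod_cast hN
  have hA : (0 : ℝ) < 144 * (d : ℝ) ^ 2 * N := by positivity
  have hB : (0 : ℝ) < 2 ^ 9 * (N : ℝ) ^ 10 := by positivity
  have hC : (0 : ℝ) < 3960 * 144 ^ 9 * (d : ℝ) ^ 18 * N ^ 10 := by positivity
  have hc9 : (0 : ℝ) < c₁ ^ 9 := by positivity
  refine ⟨min (1 / (144 * (d : ℝ) ^ 2 * N))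
      (min (c₁ ^ 9 / (2 ^ 9 * (N : ℝ) ^ 10)) (c₁ ^ 9 / (3960 * 144 ^ 9 * (d : ℝ) ^ 18 * N ^ 10))),
    lt_min (by positivity) (lt_min (by positivity) (by positivity)), ?_⟩
  intro P L _ _ hP hL β hβ hβ0
  have h1 : β ≤ 1 / (144 * (d : ℝ) ^ 2 * N) := (le_min_iff.1 hβ0).1
  have h2 : β ≤ c₁ ^ 9 / (2 ^ 9 * (N : ℝ) ^ 10) := (le_min_iff.1 (le_min_iff.1 hβ0).2).1
  have h3 : β ≤ c₁ ^ 9 / (3960 * 144 ^ 9 * (d : ℝ) ^ 18 * N ^ 10) :=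
    (le_min_iff.1 (le_min_iff.1 hβ0).2).2
  rw [le_div_iff₀ hA] at h1
  rw [le_div_iff₀ hB] at h2
  rw [le_div_iff₀ hC] at h3
  have hβ2 : 144 * (d : ℝ) ^ 2 * N * β ≤ 1 := by linarith
  have hβ3 : 2 ^ 9 * (N : ℝ) ^ 10 * β ≤ c₁ ^ 9 := by linarith
  have hβ4 : 3960 * 144 ^ 9 * (d : ℝ) ^ 18 * N ^ 10 * β ≤ c₁ ^ 9 := by linarith
  exact not_redSiteRP_of_trickSum_neg' ρ q hP hij hq1 hq2 hρ
    (trickSum_neg_of_window ρ q hP hij hL hq1 hq2 hρ hN hz₀ hω hc₁ hR1 hβ hβ2 hβ3 hβ4)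

/-- ★★ **`G ≅ SU(N)`, `N ≥ 2`**: one `β₀ = β₀(d, N) > 0` such that reduced-half site RP along `i`
fails on every even square tilted box (`P ≥ 2`, `L ≥ 2`, `d ≥ 3`) for all `0 < β ≤ β₀`. [folklore] -/
theorem not_redSiteRP_uniform_specialUnitary (hij : i ≠ j) (hq1 : q.1.1 ≠ i) (hq2 : q.1.2 ≠ i)
    (hρ : IsSpecialUnitaryModel ρ) (hN : 2 ≤ N) :
    ∃ β₀ : ℝ, 0 < β₀ ∧ ∀ (P L : ℕ) [NeZero P] [NeZero L], 2 ≤ P → 2 ≤ L →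
      ∀ β : ℝ, 0 < β → β ≤ β₀ → ¬ RedSiteRP d i j L P ρ hij β := by
  obtain ⟨z₀, ω, hω, hz₀⟩ := DiagRPSUN.exists_smul_one ρ hρ hN
  obtain ⟨c₁, hc₁, hR1⟩ := DiagRPSUN.exists_re_conv_const ρ hρ hN
  exact not_redSiteRP_uniform_of_moments ρ q hij hq1 hq2 hρ.1 (by omega) hz₀ hω hc₁ hR1

/-- ★★ **`G ≅ U(N)`, `N ≥ 1`**: one `β₀ = β₀(d, N) > 0` for every even square tilted box.
[folklore] -/
theorem not_redSiteRP_uniform_unitary (hij : i ≠ j) (hq1 : q.1.1 ≠ i) (hq2 : q.1.2 ≠ i)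
    (hρ : IsUnitaryModel ρ) (hN : 1 ≤ N) :
    ∃ β₀ : ℝ, 0 < β₀ ∧ ∀ (P L : ℕ) [NeZero P] [NeZero L], 2 ≤ P → 2 ≤ L →
      ∀ β : ℝ, 0 < β → β ≤ β₀ → ¬ RedSiteRP d i j L P ρ hij β := by
  obtain ⟨z₀, ω, hω, hz₀⟩ := DiagRPSUN.exists_smul_one_unitary ρ hρ
  have hNpos : (0 : ℝ) < N := by exact_mod_cast hN
  exact not_redSiteRP_uniform_of_moments ρ q hij hq1 hq2 hρ.1 hN hz₀ hω
    (c₁ := (2 * N : ℝ)⁻¹) (by positivity) (DiagRPSUN.integral_re_trace_mul_inv_mul_unitary ρ hρ)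

/-- ★★ **With a transverse axis `k ∉ {i, j}` (`d ≥ 3`), `G ≅ SU(N)`, `N ≥ 2`**: one window for all
even square tilted boxes. [folklore] -/
theorem not_redSiteRP_uniform_specialUnitary_of_axis {k : Fin d} (hij : i ≠ j) (hki : k ≠ i)
    (hkj : k ≠ j) (hρ : IsSpecialUnitaryModel ρ) (hN : 2 ≤ N) :
    ∃ β₀ : ℝ, 0 < β₀ ∧ ∀ (P L : ℕ) [NeZero P] [NeZero L], 2 ≤ P → 2 ≤ L →
      ∀ β : ℝ, 0 < β → β ≤ β₀ → ¬ RedSiteRP d i j L P ρ hij β :=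
  not_redSiteRP_uniform_specialUnitary ρ (mkDirPair j k hkj) hij
    (mkDirPair_ne_axis hij hki hkj).1 (mkDirPair_ne_axis hij hki hkj).2 hρ hN

/-- ★★ **With a transverse axis `k ∉ {i, j}`, `G ≅ U(N)`, `N ≥ 1`.** [folklore] -/
theorem not_redSiteRP_uniform_unitary_of_axis {k : Fin d} (hij : i ≠ j) (hki : k ≠ i)
    (hkj : k ≠ j) (hρ : IsUnitaryModel ρ) (hN : 1 ≤ N) :
    ∃ β₀ : ℝ, 0 < β₀ ∧ ∀ (P L : ℕ) [NeZero P] [NeZero L], 2 ≤ P → 2 ≤ L →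
      ∀ β : ℝ, 0 < β → β ≤ β₀ → ¬ RedSiteRP d i j L P ρ hij β :=
  not_redSiteRP_uniform_unitary ρ (mkDirPair j k hkj) hij
    (mkDirPair_ne_axis hij hki hkj).1 (mkDirPair_ne_axis hij hki hkj).2 hρ hN

end Uniform


end RedSite

end TiltedRP

end Summit.QuantumFields.GaugeBoot

end
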